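import Summits.BirchSwinnertonDyer.BirchSwinnertonDyer.Theorems.SignedBaseChangeAnticyclotomicEisensteinDivisibilityCoinducedDualFunctorial
import Summits.BirchSwinnertonDyer.BirchSwinnertonDyer.Theorems.SignedBaseChangeAnticyclotomicEisensteinDivisibilityGroupLikeAeval
import Mathlib.LinearAlgebra.Matrix.Polynomial
import Mathlib.LinearAlgebra.Matrix.Adjugate
import HarnessLib

/-!
# The DETERMINANT form of Greenberg 2010 Lemma 5.2.2 for `𝐃 = Ind(A)` of ANY corank and ANY `ρ₀` — pure
# algebra: a twisted-equivariant functional on `𝐃` vanishes (LOC-core) and a non-zero scalar of `Λ₂` kills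
# the fixed vectors (H⁰-core) (crux `AnticyclotomicEisensteinDivisibility`, stmt-BirchSwinnertonDyer-20727,
# line `bdpline` v19, registered stub `stub_twistDeformationLOC1SS`; helper for stmt-BirchSwinnertonDyer-20727)

Cell `bsd-ssimc` (hosting route `SignedBaseChange`), width seat `bsd-line-sbc-p1-w2` gen 4; second file of
the lane after `…CoinducedDualFunctorial` (p630273: adjoint matrices act on the Mahler dual datum
`T_A ⊗ Λ₂ ≅ Hom(Ind(A), C)`). [Greenberg2010] Lemma 5.2.2 (PDF p. 28): "Suppose that `v ∈ Σ` and that the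
decomposition subgroup of `Γ` for `v` is nontrivial. Then `H⁰(K_v, T*) = 0`." Greenberg's proof: `T*` is
free over the DOMAIN `Λ` and `σ` acts on it as `κ(σ)⁻¹ ⊗ ρ₀*(σ)`, whose fixed vectors die because a
non-constant group-like element of `Λ` is no eigenvalue of a constant matrix. Typed here WITHOUT any
assumption on `ρ₀(σ)` (for `E[p^∞]` the decomposition groups act through genuine matrices, and at an
inert bad prime every `σ` with `κ(σ) ≠ 1` moves `μ_{p^∞}` — so neither the tree's
`Greenberg2006.twistDeformation_LOC1_of_ne_one` (`ρ₀(σ) = 1`, `σ|μ = 1`) nor bsd-eis's corank-one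
`TwistDeformationCofree.twistDeformation_LOC1` (scalar action) applies):

* §1 `det_smul_map_sub_map_eq_aeval`: `det(u·Q_M − Q_s) = P(u)`, `P = det(X·Q_M − Q_s) ∈ 𝒪[X]`
  (determinants commute with `aeval u`); `det_X_smul_add_ne_zero`: `P ≠ 0` when `det Q_M` is a unit
  (Mathlib `Polynomial.coeff_det_X_add_C_card`: the `Xⁿ`-coefficient is `det Q_M`).
* §2 **`eq_zero_of_apply_mapRange_transSeries_smul`** (LOC-core): for `A` `p`-primary with a `C`-valued
  dual datum free of rank `n` over a domain `𝒪 ⊇ ℤ_p`, an invertible `𝒪`-linear `M`, `(c₁, c₂) ≠ 0` and ANY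
  additive `s : C → C`, every additive `f : Ind(A) → C` with `f(M_{**}((1+T₁)^{c₁}(1+T₂)^{c₂} • Φ)) = s(f Φ)`
  is zero — `f = ⟨y, ·⟩`, `(u·Q_M − Q_s)·y = 0` by the functoriality of p630273, `det = P(u) ≠ 0` by
  `SignedBaseChangeAcDivGroupLikeAeval.aeval_transSeries_ne_zero` (p626784), adjugate, `Λ₂` a domain.
* §3 **`exists_ne_zero_smul_eq_zero_of_mapRange_transSeries_smul_eq`** (H⁰-core): with a free Pontryagin
  dual (`C = ℚ/ℤ`) the scalar `λ = det(u·Q_M − 1) ≠ 0` kills every `Φ` with `M_{**}(u • Φ) = Φ`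
  (adjugate on the dual side; Pontryagin characters separate points, Mathlib
  `CharacterModule.eq_zero_of_character_apply`).

Theorems only; no definition, no named fact, no `sorry`. HONEST FRAMING: generic algebra; closes nothing
by itself (`--supports stmt-BirchSwinnertonDyer-20727`); the Galois wrappers (LOC_v⁽¹⁾, `corank H⁰ = 0`
for the twist deformation, the registered stub) are the next file; no summit statement / BSD is proved by
this file. References: [Greenberg2010] R. Greenberg, *Surjectivity of the global-to-local map defining a
Selmer group*, Kyoto J. Math. 50 (2010), §5 (PDF p. 26 L3–17), Lemma 5.2.2 (PDF p. 28 L20–21);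
[Greenberg2006] Doc. Math. Extra Vol. Coates (2006), p. 342 L35–41, §4 A Props. 4.1–4.2 pp. 367–368;
[Greenberg2016Selmer] §4.3 p. 20 L26–30.
-/

-- `Summit.BirchSwinnertonDyer.BirchSwinnertonDyer.…`: summit and sub-problem share a name (D-0017 layout).
set_option linter.dupNamespace false
set_option autoImplicit false

noncomputable section

open scoped Classical
open Finset PowerSeries Matrix
open Literature.NumberTheory.EllipticCurves Literature.NumberTheory.EllipticCurves.BigRepModule
  Literature.NumberTheory.IwasawaTheory.Greenberg2016 Literature.NumberTheory.IwasawaTheory.Greenberg2006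

universe u

namespace Summit.BirchSwinnertonDyer.BirchSwinnertonDyer.Theorems.SignedBaseChangeAcDivDeterminant

open SignedBaseChangeAcDivDualFunctorial SignedBaseChangeAcDivGroupLikeAeval

/-! ## §1 The determinant `det(u·Q_M − Q_s)` is the value at `u` of a polynomial with leading
coefficient `det Q_M` -/

section DetPoly

variable {𝒪 : Type u} [CommRing 𝒪] {n : ℕ}

/-- `(Q.map C).map C = Q.map (algebraMap 𝒪 Λ₂)` for `Λ₂ = 𝒪⟦T₂⟧⟦T₁⟧`. [folklore] -/
theorem map_C_map_C (Q : Matrix (Fin n) (Fin n) 𝒪) :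
    (Q.map (PowerSeries.C (R := 𝒪))).map (PowerSeries.C (R := PowerSeries 𝒪)) =
      Q.map (algebraMap 𝒪 (PowerSeries (PowerSeries 𝒪))) := by
  ext i j
  simp only [Matrix.map_apply, PowerSeries.algebraMap_apply, Algebra.algebraMap_self, RingHom.id_apply]

/-- **`det(u · Q_M − Q_s) = P(u)` for the polynomial `P = det(X · Q_M − Q_s) ∈ 𝒪[X]`** (determinants
commute with ring maps). [cite: Greenberg2010, Lemma 5.2.2 (PDF p. 28 L20–21)] -/
theorem det_smul_map_sub_map_eq_aeval {R : Type u} [CommRing R] [Algebra 𝒪 R] (u : R)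
    (QM Qs : Matrix (Fin n) (Fin n) 𝒪) :
    (u • QM.map (algebraMap 𝒪 R) - Qs.map (algebraMap 𝒪 R)).det =
      Polynomial.aeval u (((Polynomial.X : Polynomial 𝒪) • QM.map Polynomial.C + (-Qs).map Polynomial.C).det) := by
  rw [AlgHom.map_det]
  congr 1
  ext i j
  simp only [AlgHom.mapMatrix_apply, Matrix.map_apply, Matrix.sub_apply, Matrix.smul_apply, Matrix.add_apply,
    Matrix.neg_apply, smul_eq_mul, map_add, map_mul, map_neg, Polynomial.aeval_X, Polynomial.aeval_C,
    sub_eq_add_neg]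

/-- **`P = det(X · Q_M − Q_s) ≠ 0` when `det Q_M` is a unit**: its coefficient of `Xⁿ` is `det Q_M`
(Mathlib `Polynomial.coeff_det_X_add_C_card`). [cite: Greenberg2010, Lemma 5.2.2 (PDF p. 28 L20–21)] -/
theorem det_X_smul_add_ne_zero [Nontrivial 𝒪] {QM : Matrix (Fin n) (Fin n) 𝒪} (hQM : IsUnit QM.det)
    (Qs : Matrix (Fin n) (Fin n) 𝒪) :
    ((Polynomial.X : Polynomial 𝒪) • QM.map Polynomial.C + (-Qs).map Polynomial.C).det ≠ 0 := by
  intro h0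
  have h := Polynomial.coeff_det_X_add_C_card QM (-Qs)
  rw [h0, Polynomial.coeff_zero] at h
  exact hQM.ne_zero h.symm

end DetPoly

/-! ## §2 LOC-core: a twisted-equivariant functional on `𝐃 = Ind(A)` vanishes -/

section Core

variable {𝒪 : Type u} [CommRing 𝒪] [IsDomain 𝒪] {p : ℕ} [Fact p.Prime] [Algebra ℤ_[p] 𝒪]
  {A : Type u} [AddCommGroup A] [Module 𝒪 A]
  (hinj : Function.Injective (algebraMap ℤ_[p] 𝒪)) (hA : ∀ a : A, ∃ k : ℕ, p ^ k • a = 0)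
  {C : Type*} [AddCommGroup C] {Y : Type u} [AddCommGroup Y] [Module 𝒪 Y] {tA : Y →+ (A →+ C)}
  (hY : IsDualPairing 𝒪 A tA) {n : ℕ} (b : Module.Basis (Fin n) 𝒪 Y)

include hinj hA hY b in
/-- **LOC-core — the determinant form of Greenberg 2010 Lemma 5.2.2 for `𝐃 = Ind(A)` of ANY corank and
ANY `ρ₀`.** Let `M` be an invertible `𝒪`-linear endomorphism of the `p`-primary `A` (a `C`-valued dual
datum of `A` being free of rank `n`), `u = (1+T₁)^{c₁}(1+T₂)^{c₂}` with `(c₁, c₂) ≠ 0`, and `s` ANY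
additive endomorphism of `C`. An additive `f : 𝐃 → C` with `f(M_{**}(u • Φ)) = s(f Φ)` for all `Φ` is
ZERO: `f = ⟨y, ·⟩` on the free `Λ₂`-module `T_A ⊗ Λ₂` (structure theorem), the relation reads
`(u · Q_M − Q_s) y = 0` for the CONSTANT adjoint matrices of `M` and `s`, and
`det(u · Q_M − Q_s) = P(u) ≠ 0` in the domain `Λ₂` because `P` has leading coefficient `det Q_M ∈ 𝒪ˣ`
and `u` is a non-trivial group-like element (`aeval_transSeries_ne_zero`). For `M = ρ₀(σ̄)`,
`(c₁, c₂) = −κ(σ)`, `s = σ|_{K̄ˣ}` this is `(T*)^{σ} = 0`. [cite: Greenberg2010, Lemma 5.2.2 (PDF p. 28 L20–21), §5 (PDF p. 26 L3–17)]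
[cite: Greenberg2006, p. 342 L35–36] -/
theorem eq_zero_of_apply_mapRange_transSeries_smul (M M' : A →ₗ[𝒪] A) (hMM' : ∀ a : A, M (M' a) = a)
    {c₁ c₂ : ℤ_[p]} (hc : c₁ ≠ 0 ∨ c₂ ≠ 0) (s : C →+ C) (f : IndModule₂ 𝒪 p A →+ C)
    (hf : ∀ Φ : IndModule₂ 𝒪 p A,
      f (mapRange (mapRangeₗ M) (IndModule₂.transSeries 𝒪 c₁ c₂ • Φ)) = s (f Φ)) :
    f = 0 := by
  obtain ⟨QM, hQM⟩ := exists_matrix_adjoint_comp hY b M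
  obtain ⟨QM', hQM'⟩ := exists_matrix_adjoint_comp hY b M'
  obtain ⟨Qs, hQs⟩ := exists_matrix_adjoint_map hY b s
  have hX := IndModule₂.isDualPairing_seriesToDual₂ hA b hY
  obtain ⟨y, rfl⟩ := hX.bijective.2 f
  set u : PowerSeries (PowerSeries 𝒪) := IndModule₂.transSeries 𝒪 c₁ c₂ with hu
  set B : Matrix (Fin n) (Fin n) (PowerSeries (PowerSeries 𝒪)) :=
    u • QM.map (algebraMap 𝒪 _) - Qs.map (algebraMap 𝒪 _) with hB
  -- the linear relation `B y = 0`
  have hrel : B *ᵥ y = 0 := by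
    apply hX.injective
    rw [map_zero]
    ext Φ
    rw [hB, Matrix.sub_mulVec, Matrix.smul_mulVec, map_sub, AddMonoidHom.sub_apply, hX.map_smul,
      ← map_C_map_C, ← map_C_map_C, seriesToDual₂_map_mulVec_of_comp hA hY b M hQM,
      seriesToDual₂_map_mulVec_of_map hA hY b s hQs, hf, sub_self, AddMonoidHom.zero_apply]
  -- `det B ≠ 0`
  have hBdet : B.det ≠ 0 := by
    rw [hB, det_smul_map_sub_map_eq_aeval]
    exact aeval_transSeries_ne_zero hinj hc
      (det_X_smul_add_ne_zero (isUnit_det_of_adjoint_of_leftInverse hY b hMM' hQM hQM') Qs)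
  -- adjugate: `det B • y = 0`, hence `y = 0`
  have hy : B.det • y = 0 := by
    rw [← Matrix.one_mulVec y, ← Matrix.smul_mulVec, ← Matrix.adjugate_mul, ← Matrix.mulVec_mulVec, hrel,
      Matrix.mulVec_zero]
  rw [(smul_eq_zero.mp hy).resolve_left hBdet, map_zero]

/-! ## §3 H⁰-core: a non-zero scalar kills the `σ`-invariants of `𝐃` -/

variable {Y₀ : Type u} [AddCommGroup Y₀] [Module 𝒪 Y₀] {t₀ : Y₀ →+ (A →+ AddCircle (1 : ℚ))}
  (hY₀ : IsDualPairing 𝒪 A t₀) {n₀ : ℕ} (b₀ : Module.Basis (Fin n₀) 𝒪 Y₀)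

include hinj hA hY₀ b₀ in
/-- **H⁰-core — a NON-ZERO `λ ∈ Λ₂` kills every `Φ ∈ 𝐃 = Ind(A)` fixed by `Φ ↦ M_{**}(u • Φ)`** (`M`
invertible, `u = (1+T₁)^{c₁}(1+T₂)^{c₂}`, `(c₁, c₂) ≠ 0`; `A` `p`-primary with a free Pontryagin dual of rank
`n₀`): `λ = det(u · Q_M − 1) = P₀(u)`, `P₀` with leading coefficient `det Q_M ∈ 𝒪ˣ`. For a fixed `Φ` and every
`z ∈ T_A ⊗ Λ₂`, `⟨(u·Q_M − 1) z, Φ⟩ = 0`; with `z = adj · w` this is `⟨w, λ • Φ⟩ = 0` for every Pontryagin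
character `⟨w, ·⟩` of `𝐃`, so `λ • Φ = 0` (characters separate points). Dual form of `corank H⁰ = 0` in
[Greenberg2006] Props. 4.1/4.2 for the twist deformation. [cite: Greenberg2010, Lemma 5.2.2 (PDF p. 28 L20–21)]
[cite: Greenberg2006, §4 A pp. 367–368 (the terms corank H⁰)] -/
theorem exists_ne_zero_smul_eq_zero_of_mapRange_transSeries_smul_eq (M M' : A →ₗ[𝒪] A)
    (hMM' : ∀ a : A, M (M' a) = a) {c₁ c₂ : ℤ_[p]} (hc : c₁ ≠ 0 ∨ c₂ ≠ 0) :
    ∃ lam : PowerSeries (PowerSeries 𝒪), lam ≠ 0 ∧ ∀ Φ : IndModule₂ 𝒪 p A,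
      mapRange (mapRangeₗ M) (IndModule₂.transSeries 𝒪 c₁ c₂ • Φ) = Φ → lam • Φ = 0 := by
  obtain ⟨QM, hQM⟩ := exists_matrix_adjoint_comp hY₀ b₀ M
  obtain ⟨QM', hQM'⟩ := exists_matrix_adjoint_comp hY₀ b₀ M'
  have hX := IndModule₂.isDualPairing_seriesToDual₂ hA b₀ hY₀
  set u : PowerSeries (PowerSeries 𝒪) := IndModule₂.transSeries 𝒪 c₁ c₂ with hu
  set B : Matrix (Fin n₀) (Fin n₀) (PowerSeries (PowerSeries 𝒪)) :=
    u • QM.map (algebraMap 𝒪 _) - (1 : Matrix (Fin n₀) (Fin n₀) 𝒪).map (algebraMap 𝒪 _) with hB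
  have hBdet : B.det ≠ 0 := by
    rw [hB, det_smul_map_sub_map_eq_aeval]
    exact aeval_transSeries_ne_zero hinj hc
      (det_X_smul_add_ne_zero (isUnit_det_of_adjoint_of_leftInverse hY₀ b₀ hMM' hQM hQM') 1)
  refine ⟨B.det, hBdet, fun Φ hΦ ↦ ?_⟩
  -- `⟨B z, Φ⟩ = 0` for every `z`
  have hz : ∀ z : Fin n₀ → PowerSeries (PowerSeries 𝒪), IndModule₂.seriesToDual₂ t₀ b₀ (B *ᵥ z) Φ = 0 := by
    intro z
    rw [hB, Matrix.sub_mulVec, Matrix.smul_mulVec, Matrix.map_one (algebraMap 𝒪 _) (map_zero _) (map_one _),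
      Matrix.one_mulVec, map_sub, AddMonoidHom.sub_apply, hX.map_smul, ← map_C_map_C,
      seriesToDual₂_map_mulVec_of_comp hA hY₀ b₀ M hQM, hΦ, sub_self]
  -- characters separate points
  refine CharacterModule.eq_zero_of_character_apply fun c ↦ ?_
  obtain ⟨w, hw⟩ := hX.bijective.2 c
  have h := hz (B.adjugate *ᵥ w)
  rw [Matrix.mulVec_mulVec, Matrix.mul_adjugate, Matrix.smul_mulVec, Matrix.one_mulVec, hX.map_smul] at h
  rw [← hw]
  exact h

end Core

end Summit.BirchSwinnertonDyer.BirchSwinnertonDyer.Theorems.SignedBaseChangeAcDivDeterminant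

end
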